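import Summits.HodgeConjecture.HodgeConjecture.Theorems.MarkmanPartnerTransportK3Sq2KugaSatakeOrphanKSVarescoFree
import Summits.HodgeConjecture.HodgeConjecture.Theorems.MarkmanPartnerTransportLowPicardRMOddCellSockets
import Summits.HodgeConjecture.HodgeConjecture.Theorems.MarkmanPartnerTransportLowPicardRMPicardOneKugaSatake

/-!
# Route MarkmanPartnerTransport · crux `LowPicardRealMultiplication` (stmt-HodgeConjecture-19653) —
# programme «KS-SELF-X», step 6: crux #5 from Kuga–Satake + one cycle per member, and «Kuga–Satake ⇒ HC⁴(X)» at
# Picard rank `1`, WITHOUT Varesco's record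

Varesco-free twins (via `…K3Sq2KugaSatakeOrphanKSVarescoFree`, this seat) of the two remaining crux-#5 consumers of
`Varesco2023_transcendentalHodgeSimilitude_algebraic_of_lefschetzStandard`:

* `lowPicardRealMultiplication_of_kugaSatakeHK_of_forall_oneCellCycle` — crux #5 `LowPicardRealMultiplication` BY
  NAME from Kuga–Satake on the quadratic cells `(1,2)`, `(3,2)` and one degree-`d` RM cycle per member on the cells
  `(2,3)`, `(2,7)`, `(3,4)`, `(3,5)` (twin of `lowPicardRealMultiplication_of_kugaSatake_of_forall_oneCellCycle`);
* `hodgeConjectureFor_of_picard_one_of_kugaSatakeHK'` — **«Kuga–Satake for `X` ⇒ HC⁴(X)» for EVERY marked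
  projective `K3^{[2]}`-type fourfold of Picard rank `1`** (isometry-spanned ⇒ support #3 by name; otherwise the
  Varesco-free «CELL12-KS»), modulo {Verbitsky–Guan, O'Grady 2008, Charles–Markman 2013, Markman 2024} — twin of
  `hodgeConjectureFor_of_picard_one_of_kugaSatake'` with the Varesco and Beauville records REMOVED.

CONDITIONAL on the Kuga–Satake statement for the fourfolds concerned (OPEN in print) and on the displayed records;
credits nothing to HC. THEOREMS ONLY; no sorry, no definition, no new named fact. Prover seat hodge-nonav-19652-p1
(gen 15), `--supports stmt-HodgeConjecture-19653`.

References: M. Varesco, Math. Z. 305 (2023) Cor. 4.6, Conj. 4.2; E. Markman, *Rational Hodge isometries of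
hyper-Kähler varieties of K3^[n] type are algebraic* (2024) Thm. 1.1; F. Charles, E. Markman, Compos. Math. 149 (2013)
Thm. 1.1; B. van Geemen, Michigan Math. J. 56 (2008) Lemma 3.2.
-/

noncomputable section

set_option linter.dupNamespace false

open scoped TensorProduct
open Module CategoryTheory MonoidalCategory Polynomial
open Literature.AlgebraicTopology.SingularHomology Literature.Geometry.Kaehler
open Literature.AlgebraicGeometry Literature.AlgebraicGeometry.Motives Literature.AlgebraicGeometry.HodgeTheory
open Literature.AlgebraicGeometry.Hyperkaehler Literature.AlgebraicGeometry.Surfaces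
open Summit.HodgeConjecture.HodgeConjecture.Theorems.NikulinTwinTransport
open Summit.HodgeConjecture.HodgeConjecture.Theorems.MarkmanPartnerTransport

namespace Summit.HodgeConjecture.HodgeConjecture.Theorems.MarkmanPartnerTransport.PartnerLattice

/-- `MarkedK3Sq[X, φ, P, z]`: VERBATIM the `let MarkedK3Sq := …` binder of the route declarations of
MarkmanPartnerTransport (clauses (m1)–(m6)). Local notation only. -/
local notation3 (prettyPrint := false) "MarkedK3Sq[" X ", " φ ", " P ", " z "]" =>
  (((IsIntegralClass P ∧ ∀ Q : complexBetti X (2 * 4), IsIntegralClass Q → ∃ n : ℤ, Q = n • P) ∧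
    (∀ c : complexBetti X 2, IsIntegralClass c ↔ ∃ v : K3HilbertIndex → ℤ, φ c = fun i => (v i : ℂ)) ∧
    (∀ a : complexBetti X 2, cupPowTwo a 4 = ((3 : ℂ) * (k3HilbertForm 2 (φ a) (φ a)) ^ 2) • P) ∧
    (IsOfHodgeType 4 X 2 2 0 (LinearEquiv.symm φ z) ∧
      ∀ τ : complexBetti X 2, IsOfHodgeType 4 X 2 2 0 τ → ∃ t : ℂ, τ = t • LinearEquiv.symm φ z) ∧
    (∀ c : complexBetti X 2, IsOfHodgeType 4 X 2 1 1 c ↔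
      (k3HilbertForm 2 (φ c) z = 0 ∧ k3HilbertForm 2 (φ c) (star z) = 0)) ∧
    (k3HilbertForm 2 z z = 0 ∧ 0 < (k3HilbertForm 2 (star z) z).re)))

/-- `SpIso[X, φ]`: VERBATIM the `let SpannedByIsometries := …` binder of the route declarations (with
`IsBBFTransc` unfolded). Local notation only. -/
local notation3 (prettyPrint := false) "SpIso[" X ", " φ "]" =>
  (∀ f : complexBetti X 2 →ₗ[ℂ] complexBetti X 2, (∀ y, IsRationalClass y → IsRationalClass (f y)) →
    (∀ (i j : ℕ) y, IsOfHodgeType 4 X 2 i j y → IsOfHodgeType 4 X 2 i j (f y)) →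
    (∀ d : complexBetti X 2, d ∈ algebraicClasses X 1 → f d = 0) →
    (∀ y : complexBetti X 2, ∀ d : complexBetti X 2, d ∈ algebraicClasses X 1 →
      k3HilbertForm 2 (φ (f y)) (φ d) = 0) →
    ∃ (k : ℕ) (c : Fin k → ℚ) (g : Fin k → (complexBetti X 2 →ₗ[ℂ] complexBetti X 2)),
      (∀ i, Function.Bijective (g i) ∧ (∀ y, IsRationalClass y → IsRationalClass (g i y)) ∧
        (∀ (a b : ℕ) y, IsOfHodgeType 4 X 2 a b y → IsOfHodgeType 4 X 2 a b (g i y)) ∧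
        (∀ a b, k3HilbertForm 2 (φ (g i a)) (φ (g i b)) = k3HilbertForm 2 (φ a) (φ b))) ∧
      ∀ y : complexBetti X 2, (∀ d : complexBetti X 2, d ∈ algebraicClasses X 1 →
        k3HilbertForm 2 (φ y) (φ d) = 0) → f y = ∑ i : Fin k, ((c i : ℂ) • g i y))

/-- `RMgen[X, φ, z, d]` (VERBATIM `…LowPicardRMCells`): a rational, type-preserving, `q`-self-adjoint endomorphism
`θ` of `H²(X(ℂ); ℂ)` with `θ σ = ev · σ`, `ev` real, `deg minpoly_ℚ(ev) = d`, `d · n + ρ(X) = 23` for some `n ≥ 3`, and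
GEN: every rational type-preserving endomorphism is `Σ_{i<d} cᵢ θⁱ` (`cᵢ ∈ ℚ`) on `T(X)_ℂ`. Local notation only. -/
local notation3 (prettyPrint := false) "RMgen[" X ", " φ ", " z ", " d "]" =>
  (∃ θ : complexBetti X 2 →ₗ[ℂ] complexBetti X 2, (∀ y, IsRationalClass y → IsRationalClass (θ y)) ∧
    (∀ (i j : ℕ) y, IsOfHodgeType 4 X 2 i j y → IsOfHodgeType 4 X 2 i j (θ y)) ∧
    (∀ y w : complexBetti X 2, k3HilbertForm 2 (φ (θ y)) (φ w) = k3HilbertForm 2 (φ y) (φ (θ w))) ∧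
    ∃ ev : ℂ, θ (LinearEquiv.symm φ z) = ev • LinearEquiv.symm φ z ∧ ev.im = 0 ∧
      (minpoly ℚ ev).natDegree = d ∧
      (∃ n : ℕ, 3 ≤ n ∧ d * n + Module.finrank ℂ ↥(algebraicClasses X 1) = 23) ∧
      ∀ f : complexBetti X 2 →ₗ[ℂ] complexBetti X 2, (∀ y, IsRationalClass y → IsRationalClass (f y)) →
        (∀ (i j : ℕ) y, IsOfHodgeType 4 X 2 i j y → IsOfHodgeType 4 X 2 i j (f y)) →
        ∃ c : Fin d → ℚ, ∀ y : complexBetti X 2,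
          (∀ a : complexBetti X 2, a ∈ algebraicClasses X 1 → k3HilbertForm 2 (φ y) (φ a) = 0) →
            f y = ∑ i : Fin d, ((c i : ℂ) • (θ ^ (i : ℕ)) y))

/-- `CellHC[ρ, d]` (VERBATIM `…LowPicardRMCells`): **HC⁴ on the cell `(ρ(X), [E:ℚ]) = (ρ, d)`**. Local notation only. -/
local notation3 (prettyPrint := false) "CellHC[" ρ ", " d "]" =>
  (∀ (X : SchemeOver ℂ), IsSmoothProjective 4 X → IsOfK3HilbertSquareType X →
    ∀ (φ : complexBetti X 2 ≃ₗ[ℂ] (K3HilbertIndex → ℂ)) (P : complexBetti X (2 * 4)) (z : K3HilbertIndex → ℂ),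
      MarkedK3Sq[X, φ, P, z] → ¬ SpIso[X, φ] → Module.finrank ℂ ↥(algebraicClasses X 1) = ρ →
        RMgen[X, φ, z, d] → HodgeConjectureFor 4 X)

/-- `OneRMCycle[X, φ, z, hX]` (VERBATIM `…K3Sq2OneCycleFifthRM` :60): the positive one-cycle clause (degree form) —
ONE algebraic class `Z ∈ A⁴(X × X)` whose action on `H²(X)` is rational, type-preserving, with eigenvalue `ev` on `σ`,
`deg minpoly_ℚ(ev) = k`, `k · j · m + ρ(X) ≠ 23`. Local notation only. -/
local notation3 (prettyPrint := false) "OneRMCycle[" X ", " φ ", " z ", " hX "]" =>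
  (∃ (k : ℕ) (t : complexBetti X 2 →ₗ[ℂ] complexBetti X 2),
    (∀ j m : ℕ, 2 ≤ j → 3 ≤ m → k * j * m + Module.finrank ℂ ↥(algebraicClasses X 1) ≠ 23) ∧
    (∀ y, IsRationalClass y → IsRationalClass (t y)) ∧
    (∀ (a b : ℕ) y, IsOfHodgeType 4 X 2 a b y → IsOfHodgeType 4 X 2 a b (t y)) ∧
    (∃ Z ∈ algebraicClasses (X ⊗ X) 4, ∀ y : complexBetti X 2,
      t y = corrAction complexOrientationFamily hX hX (rfl : 2 + 2 * 4 = 2 + 2 * 4) Z y) ∧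
    ∃ ev : ℂ, t (LinearEquiv.symm φ z) = ev • LinearEquiv.symm φ z ∧ (minpoly ℚ ev).natDegree = k)

/-- `OneCellCycle[X, φ, z, hX, d]`: the one-cycle datum WITHIN A CELL of degree `d` — ONE algebraic class
`Z ∈ A⁴(X × X)` whose action on `H²(X)` is rational, type-preserving, with eigenvalue `ev` on `σ = φ⁻¹ z` of minpoly
degree EXACTLY `d` (the degree `[E:ℚ]` of the cell: the cycle's eigenvalue generates the RM field). `OneRMCycle`
without its arithmetic clause, which the cell supplies (`degree_law_cell…`). Local notation only. -/
local notation3 (prettyPrint := false) "OneCellCycle[" X ", " φ ", " z ", " hX ", " d "]" =>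
  (∃ t : complexBetti X 2 →ₗ[ℂ] complexBetti X 2,
    (∀ y, IsRationalClass y → IsRationalClass (t y)) ∧
    (∀ (a b : ℕ) y, IsOfHodgeType 4 X 2 a b y → IsOfHodgeType 4 X 2 a b (t y)) ∧
    (∃ Z ∈ algebraicClasses (X ⊗ X) 4, ∀ y : complexBetti X 2,
      t y = corrAction complexOrientationFamily hX hX (rfl : 2 + 2 * 4 = 2 + 2 * 4) Z y) ∧
    ∃ ev : ℂ, t (LinearEquiv.symm φ z) = ev • LinearEquiv.symm φ z ∧ (minpoly ℚ ev).natDegree = d)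

/-- `OneCycleOnCell[ρ, d]`: «every member of the cell `(ρ, d)` carries one degree-`d` RM cycle». Local notation only. -/
local notation3 (prettyPrint := false) "OneCycleOnCell[" ρ ", " d "]" =>
  (∀ (X : SchemeOver ℂ) (hX : IsSmoothProjective 4 X), IsOfK3HilbertSquareType X →
    ∀ (φ : complexBetti X 2 ≃ₗ[ℂ] (K3HilbertIndex → ℂ)) (P : complexBetti X (2 * 4)) (z : K3HilbertIndex → ℂ),
      MarkedK3Sq[X, φ, P, z] → ¬ SpIso[X, φ] → Module.finrank ℂ ↥(algebraicClasses X 1) = ρ →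
        RMgen[X, φ, z, d] → OneCellCycle[X, φ, z, hX, d])

/-- `KSHC[hX]` (VERBATIM `…LowPicardRMCellOneTwoKugaSatake`): the Kuga–Satake Hodge conjecture for the
`K3^{[2]}`-type fourfold `X`. Local notation only. -/
local notation3 (prettyPrint := false) "KSHC[" hX "]" => (IsKSCorrespondenceAlgebraicHK 2 hX)

variable {X : SchemeOver ℂ} {φ : complexBetti X 2 ≃ₗ[ℂ] (K3HilbertIndex → ℂ)} {P : complexBetti X (2 * 4)}
  {z : K3HilbertIndex → ℂ}

/-- **Crux #5 BY NAME from Kuga–Satake on the quadratic cells `(1,2)`, `(3,2)` and one degree-`d` RM cycle per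
member on the four cells of degree `≥ 3` — Varesco-free** (`cellHC_two_of_kugaSatakeHK` for `ρ ∈ {1, 3}` + the
cell closers of `…LowPicardRMOddCellSockets` + «CELL-SPLIT»). Modulo {Verbitsky–Guan, O'Grady, Charles–Markman 2013};
CONDITIONAL on `KSHC` for the quadratic cells and on the one-cycle clauses; credits nothing to HC.
[cite: Varesco2023, Cor. 4.6 and Conj. 4.2] [cite: CharlesMarkman2013, Thm. 1.1 (§1)] [cite: Markman2024, §1.1 Thm. 1.1]
[cite: Vangeemen2008, Lemma 3.2] -/
theorem lowPicardRealMultiplication_of_kugaSatakeHK_of_forall_oneCellCycle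
    (hV : VerbitskyGuan_cohomology_K3HilbertSquareType) (hO : OGrady2008_dualBBFClass_algebraic)
    (hB : CharlesMarkman2013_lefschetzStandard_K3HilbertType)
    (hKS : ∀ (X : SchemeOver ℂ) (hX : IsSmoothProjective 4 X), IsOfK3HilbertSquareType X →
      ∀ (φ : complexBetti X 2 ≃ₗ[ℂ] (K3HilbertIndex → ℂ)) (P : complexBetti X (2 * 4)) (z : K3HilbertIndex → ℂ),
        MarkedK3Sq[X, φ, P, z] → ¬ SpIso[X, φ] → RMgen[X, φ, z, 2] → KSHC[hX])
    (h23 : OneCycleOnCell[2, 3]) (h27 : OneCycleOnCell[2, 7]) (h34 : OneCycleOnCell[3, 4]) (h35 : OneCycleOnCell[3, 5]) :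
    Summit.HodgeConjecture.HodgeConjecture.Theses.MarkmanPartnerTransport.LowPicardRealMultiplication :=
  have hQ : QInvAlgebraic := qInvAlgebraic_of_charlesMarkman hV hB
  lowPicardRealMultiplication_of_kugaSatakeHK_of_four_cells hV hO hB hKS
    (cellHC_of_forall_oneCellCycle_23 hV hO hQ h23) (cellHC_of_forall_oneCellCycle_27 hV hO hQ h27)
    (cellHC_of_forall_oneCellCycle_34 hV hO hQ h34) (cellHC_of_forall_oneCellCycle_35 hV hO hQ h35)

/-- **«Kuga–Satake for `X` ⇒ HC⁴(X)» at Picard rank `1`, all cases, Varesco-free**: isometry-spanned ⇒ support #3 by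
name (`isometrySpannedThird_of_three_facts`); otherwise `hodgeConjectureFor_of_picard_one_of_kugaSatakeHK`.
CONDITIONAL on the Kuga–Satake statement for `X`; records {Verbitsky–Guan, O'Grady 2008, Charles–Markman 2013,
Markman 2024} displayed. Credits nothing to HC. [cite: Varesco2023, Cor. 4.6 and Conj. 4.2] [cite: Markman2024, Thm. 1.1]
[cite: CharlesMarkman2013, Thm. 1.1 (§1)] -/
theorem hodgeConjectureFor_of_picard_one_of_kugaSatakeHK'
    (hV : VerbitskyGuan_cohomology_K3HilbertSquareType) (hO : OGrady2008_dualBBFClass_algebraic)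
    (hB : CharlesMarkman2013_lefschetzStandard_K3HilbertType) (hMk : Markman2024_rationalHodgeIsometry_algebraic_marked)
    (hX : IsSmoothProjective 4 X) (hK : IsOfK3HilbertSquareType X) (hM : MarkedK3Sq[X, φ, P, z])
    (hρ : Module.finrank ℂ ↥(algebraicClasses X 1) = 1) (hKS : KSHC[hX]) : HodgeConjectureFor 4 X := by
  by_cases hsp : SpIso[X, φ]
  · exact isometrySpannedThird_of_three_facts hV hB hMk X hX hK φ P z hM hsp
  · exact hodgeConjectureFor_of_picard_one_of_kugaSatakeHK hV hO hB hX hK hM hsp hρ hKS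

end Summit.HodgeConjecture.HodgeConjecture.Theorems.MarkmanPartnerTransport.PartnerLattice

end
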